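import Mathlib
import Summits.ValiantsHypothesis.ValiantsHypothesis.Theses.BorderApolarity
import Summits.ValiantsHypothesis.ValiantsHypothesis.Theorems.BorderApolarityBorelFixedBorderApolarityTranslate
import Summits.ValiantsHypothesis.ValiantsHypothesis.Theorems.BorderApolarityBorelFixedBorderApolarityDescentA
import Summits.ValiantsHypothesis.ValiantsHypothesis.Theorems.BorderApolarityBorelFixedBorderApolarityDescentB
import Summits.ValiantsHypothesis.ValiantsHypothesis.Theorems.BorderApolarityBorelFixedBorderApolarityTorusLimit
import Summits.ValiantsHypothesis.ValiantsHypothesis.Theorems.BorderApolarityBorelFixedBorderApolarityWeightsB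
import Summits.ValiantsHypothesis.ValiantsHypothesis.Theorems.BorderApolarityBorelFixedBorderApolarityLowering
import Summits.ValiantsHypothesis.ValiantsHypothesis.Theorems.BorderApolarityBorelFixedBorderApolarityNonempty

/-!
# Border apolarity — the support item `BorelFixedBorderApolarity` (stmt-ValiantsHypothesis-5781)

Route `ValiantsHypothesis/BorderApolarity`.  We prove
`Summit.ValiantsHypothesis.ValiantsHypothesis.Theses.BorderApolarity.BorelFixedBorderApolarity`:
for `3 ≤ n ≤ m`, if the padded permanent `pp = X₀₀^{m-n} per_n` lies in `Δ(det_m)` then there is a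
sequence `P_t ∈ GL · det_m` whose annihilators `Ann_k(P_t)` converge degree-wise (`k ≤ m`) to an
`H₀(n,m)`-stable family `J` inside `Ann(pp)` (clauses W1–W5 of the route statement).

## Proof (a constructive substitute for the Borel fixed point theorem)

Let `Y` be the set of degree-wise Kuratowski limits `J = lim Ann(P_t)` (`P_t ∈ GL · det_m`) with
`J_k ⌟ pp = 0`.  `Y ≠ ∅` (`bfba_nonempty`: Zariski = Euclidean closure, compactness of the
Grassmannians, continuity of the pairing — Buczyńska–Buczyński 2021 Thm 1, necessity).  Fix the
generic anti-dominant cocharacter `μ` of the torus of `H₀` (`bfba_exists_weight`).  `Y` is stable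
under translation by substitutions fixing `pp` up to a scalar (`bfba_translate`) and under the
torus limit `J ↦ in_μ(J)` (`bfba_torusLimit`), whose values are `μ`-GRADED.  DESCENT
(`bfba_descent`): if a graded `J ∈ Y` is moved by some unipotent `V ∈ H₀ᵀ` (unit lower-triangular,
supported on the rows of the unused variables), replace it by `in_μ(V · J) ∈ Y`; the rank profile
`Σ_k Σ_ν dim (J_k ∩ F_{≥ν})` strictly decreases (`bfba_rank_le`, `bfba_map_eq_of_rank_eq`,
`bfba_rank_initSpan`; `V` is lowering for the anti-dominant `μ`, `bfba_lowering`), so the descent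
stops at a graded `J ∈ Y` stable under all such `V`.  Finally W4 (`bfba_W4_of_graded_of_unipotent`):
for `M ∈ H₀`, `Mᵀ = V · diag(M)`, the diagonal part preserves graded subspaces by the genericity of
`μ` and the unipotent part by construction.

## References

* W. Buczyńska, J. Buczyński, *Apolarity, border rank, and multigraded Hilbert scheme*, Duke
  Math. J. 170 (2021), Thm 1, Thm 31 (Fixed Ideal Theorem). [BuczynskaBuczynski2021]
* A. Borel, *Linear Algebraic Groups* (1991), §10.4 (fixed point theorem; replaced here by an
  explicit descent). [Borel1991]
-/

open MvPolynomial Filter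
open scoped BigOperators Topology Matrix

namespace Summit.ValiantsHypothesis.ValiantsHypothesis.Theorems.BorderApolarityBorelFixedBorderApolarity

set_option linter.dupNamespace false

open Literature.Computability.AlgebraicComplexity
open Summit.ValiantsHypothesis.ValiantsHypothesis.Theorems.BorderApolarityToricFixedPoints
open Summit.ValiantsHypothesis.ValiantsHypothesis.Theorems.BorderApolarityFixedWitnessObstructionQP
  (stub_kuratowskiSubmodule stub_annSubmodule)


/-- **The descent.**  Notation: `Y` = degree-wise (`k ≤ m`) limits `J` of `Ann(P_t)`,
`P_t ∈ GL · det_m`, with `J_k ⌟ pp = 0`; `μ` a weight with `pp` weighted homogeneous, `μ ≥ 0`,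
weights of degree `≤ m` bounded by `hi`, anti-dominant for the order `rk`.  For every `μ`-graded
`J ∈ Y` whose rank profile `Σ_{k ≤ m} Σ_{0 ≤ ν ≤ hi} dim (J_k ∩ F_{≥ν})` is at most `p` there is a
`μ`-graded `J' ∈ Y` stable under every unit lower-triangular `V` supported on the unused rows
(induction on `p`: if some such `V` moves `J`, then `in_μ(V · J) ∈ Y` is graded with strictly
smaller rank profile, by `bfba_rank_le` / `bfba_map_eq_of_rank_eq` / `bfba_rank_initSpan`).
[folklore] -/
theorem bfba_descent {n m : ℕ} [NeZero m] (μ : Fin m × Fin m → ℤ) (ν₀ : ℤ)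
    (hμpp : ∀ d ∈ (paddedPerPoly ℂ n m).support, Finsupp.weight μ d = ν₀)
    (hμ0 : ∀ v, 0 ≤ μ v) (hi : ℤ)
    (hμhi : ∀ e : Fin m × Fin m →₀ ℕ, e.degree ≤ m → Finsupp.weight μ e ≤ hi)
    (hAD : ∀ a b : Fin m × Fin m, ¬ ((m - n ≤ (a.1 : ℕ) ∧ m - n ≤ (a.2 : ℕ)) ∨ a = (0, 0)) →
      (if (m - n ≤ (b.1 : ℕ) ∧ m - n ≤ (b.2 : ℕ)) ∨ b = (0, 0) then 0 else m * m) +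
          ((b.1 : ℕ) * m + (b.2 : ℕ)) <
        (if (m - n ≤ (a.1 : ℕ) ∧ m - n ≤ (a.2 : ℕ)) ∨ a = (0, 0) then 0 else m * m) +
          ((a.1 : ℕ) * m + (a.2 : ℕ)) → μ a < μ b) :
    ∀ (p : ℕ) (P : ℕ → MvPolynomial (Fin m × Fin m) ℂ) (J : ℕ → Set (MvPolynomial (Fin m × Fin m) ℂ)),
      (∀ t, P t ∈ glOrbit (Fin m × Fin m) ℂ (detPoly (Fin m) ℂ)) → IsBorderApolarLimit m P J →
      (∀ k ≤ m, ∀ D ∈ J k, apolarAction D (paddedPerPoly ℂ n m) = 0) →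
      (∀ k ≤ m, ∀ D ∈ J k, ∀ ν : ℤ, weightedHomogeneousComponent μ ν D ∈ J k) →
      (∑ k ∈ Finset.range (m + 1), ∑ ν ∈ Finset.Icc (0 : ℤ) hi,
          Module.finrank ℂ ↥(Submodule.span ℂ (J k) ⊓
            restrictSupport ℂ {e : Fin m × Fin m →₀ ℕ | ν ≤ Finsupp.weight μ e})) ≤ p →
      ∃ (P' : ℕ → MvPolynomial (Fin m × Fin m) ℂ) (J' : ℕ → Set (MvPolynomial (Fin m × Fin m) ℂ)),
        (∀ t, P' t ∈ glOrbit (Fin m × Fin m) ℂ (detPoly (Fin m) ℂ)) ∧ IsBorderApolarLimit m P' J' ∧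
        (∀ k ≤ m, ∀ D ∈ J' k, apolarAction D (paddedPerPoly ℂ n m) = 0) ∧
        (∀ k ≤ m, ∀ D ∈ J' k, ∀ ν : ℤ, weightedHomogeneousComponent μ ν D ∈ J' k) ∧
        (∀ V : Matrix (Fin m × Fin m) (Fin m × Fin m) ℂ, (∀ a, V a a = 1) →
          (∀ a b : Fin m × Fin m, a ≠ b → V a b ≠ 0 →
            ¬ ((m - n ≤ (a.1 : ℕ) ∧ m - n ≤ (a.2 : ℕ)) ∨ a = (0, 0)) ∧
              (if (m - n ≤ (b.1 : ℕ) ∧ m - n ≤ (b.2 : ℕ)) ∨ b = (0, 0) then 0 else m * m) +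
                  ((b.1 : ℕ) * m + (b.2 : ℕ)) <
                (if (m - n ≤ (a.1 : ℕ) ∧ m - n ≤ (a.2 : ℕ)) ∨ a = (0, 0) then 0 else m * m) +
                  ((a.1 : ℕ) * m + (a.2 : ℕ))) →
          ∀ k ≤ m, ∀ D ∈ J' k, linSubst (Fin m × Fin m) ℂ V D ∈ J' k) := by
  classical
  haveI hfin : ∀ k, Module.Finite ℂ (homogeneousSubmodule (Fin m × Fin m) ℂ k) := fun k =>
    Module.Finite.iff_fg.2 (homogeneousSubmodule_fg _ ℂ k)
  have hw0 : ∀ e : Fin m × Fin m →₀ ℕ, 0 ≤ Finsupp.weight μ e := bfba_weight_nonneg μ hμ0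
  -- the descent step
  have hstep : ∀ (P : ℕ → MvPolynomial (Fin m × Fin m) ℂ) (J : ℕ → Set (MvPolynomial (Fin m × Fin m) ℂ)),
      (∀ t, P t ∈ glOrbit (Fin m × Fin m) ℂ (detPoly (Fin m) ℂ)) → IsBorderApolarLimit m P J →
      (∀ k ≤ m, ∀ D ∈ J k, apolarAction D (paddedPerPoly ℂ n m) = 0) →
      (∀ k ≤ m, ∀ D ∈ J k, ∀ ν : ℤ, weightedHomogeneousComponent μ ν D ∈ J k) →
      ∀ V : Matrix (Fin m × Fin m) (Fin m × Fin m) ℂ, (∀ a, V a a = 1) →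
        (∀ a b : Fin m × Fin m, a ≠ b → V a b ≠ 0 →
          ¬ ((m - n ≤ (a.1 : ℕ) ∧ m - n ≤ (a.2 : ℕ)) ∨ a = (0, 0)) ∧
            (if (m - n ≤ (b.1 : ℕ) ∧ m - n ≤ (b.2 : ℕ)) ∨ b = (0, 0) then 0 else m * m) +
                ((b.1 : ℕ) * m + (b.2 : ℕ)) <
              (if (m - n ≤ (a.1 : ℕ) ∧ m - n ≤ (a.2 : ℕ)) ∨ a = (0, 0) then 0 else m * m) +
                ((a.1 : ℕ) * m + (a.2 : ℕ))) →
        ∀ k₀ ≤ m, ∀ D₀ ∈ J k₀, linSubst (Fin m × Fin m) ℂ V D₀ ∉ J k₀ →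
        ∃ (P' : ℕ → MvPolynomial (Fin m × Fin m) ℂ) (J' : ℕ → Set (MvPolynomial (Fin m × Fin m) ℂ)),
          (∀ t, P' t ∈ glOrbit (Fin m × Fin m) ℂ (detPoly (Fin m) ℂ)) ∧ IsBorderApolarLimit m P' J' ∧
          (∀ k ≤ m, ∀ D ∈ J' k, apolarAction D (paddedPerPoly ℂ n m) = 0) ∧
          (∀ k ≤ m, ∀ D ∈ J' k, ∀ ν : ℤ, weightedHomogeneousComponent μ ν D ∈ J' k) ∧
          (∑ k ∈ Finset.range (m + 1), ∑ ν ∈ Finset.Icc (0 : ℤ) hi,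
              Module.finrank ℂ ↥(Submodule.span ℂ (J' k) ⊓
                restrictSupport ℂ {e : Fin m × Fin m →₀ ℕ | ν ≤ Finsupp.weight μ e})) <
            ∑ k ∈ Finset.range (m + 1), ∑ ν ∈ Finset.Icc (0 : ℤ) hi,
              Module.finrank ℂ ↥(Submodule.span ℂ (J k) ⊓
                restrictSupport ℂ {e : Fin m × Fin m →₀ ℕ | ν ≤ Finsupp.weight μ e}) := by
    intro P J hP hJ hJpp hgr V hV1 hUS k₀ hk₀ D₀ hD₀ hnot
    -- `V` is an invertible lowering substitution
    have hVμ : ∀ a b, a ≠ b → V a b ≠ 0 → μ a < μ b := fun a b hab h =>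
      hAD a b (hUS a b hab h).1 (hUS a b hab h).2
    have hlow := bfba_lowering μ V hV1 hVμ
    have hVu : IsUnit V.det := by
      rw [bfba_det_unipotent V hV1 hUS]
      exact isUnit_one
    set Φ : MvPolynomial (Fin m × Fin m) ℂ →ₗ[ℂ] MvPolynomial (Fin m × Fin m) ℂ :=
      (linSubst (Fin m × Fin m) ℂ V).toLinearMap with hΦ
    have hΦapp : ∀ x, Φ x = linSubst (Fin m × Fin m) ℂ V x := fun x => rfl
    have hΦinj : Function.Injective Φ := fun x y h => linSubst_injective_of_isUnit_det V hVu h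
    have hlowΦ : ∀ (ν : ℤ) (D : MvPolynomial (Fin m × Fin m) ℂ),
        (∀ e ∈ D.support, Finsupp.weight μ e ≤ ν) → ∀ e ∈ (Φ D - D).support, Finsupp.weight μ e < ν :=
      fun ν D hD => hlow ν D hD
    -- the translating matrix `A = (V⁻¹)ᵀ` fixes `pp`
    set A : Matrix (Fin m × Fin m) (Fin m × Fin m) ℂ := (V⁻¹)ᵀ with hA
    have hAunit : IsUnit A.det := by
      rw [hA, Matrix.det_transpose]
      exact Matrix.isUnit_nonsing_inv_det V hVu
    have hAT : Aᵀ = V⁻¹ := Matrix.transpose_transpose _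
    have hVrow : ∀ a : Fin m × Fin m, ((m - n ≤ (a.1 : ℕ) ∧ m - n ≤ (a.2 : ℕ)) ∨ a = (0, 0)) →
        ∀ b, V a b = if a = b then 1 else 0 := by
      intro a ha b
      by_cases hab : a = b
      · subst hab; rw [if_pos rfl, hV1]
      · rw [if_neg hab]
        by_contra h
        exact (hUS a b hab h).1 ha
    have hVinv : ∀ a : Fin m × Fin m, ((m - n ≤ (a.1 : ℕ) ∧ m - n ≤ (a.2 : ℕ)) ∨ a = (0, 0)) →
        ∀ b, V⁻¹ a b = if a = b then 1 else 0 := by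
      intro a ha b
      have h := congrFun (congrFun (Matrix.mul_nonsing_inv V hVu) a) b
      rw [Matrix.mul_apply, Finset.sum_eq_single a
        (fun c _ hca => by rw [hVrow a ha c, if_neg (Ne.symm hca), zero_mul])
        (fun h => absurd (Finset.mem_univ a) h), hVrow a ha a, if_pos rfl, one_mul,
        Matrix.one_apply] at h
      exact h
    have hApp : linSubst (Fin m × Fin m) ℂ A (paddedPerPoly ℂ n m) = (1 : ℂ) • paddedPerPoly ℂ n m := by
      rw [one_smul]
      exact bfba_linSubst_paddedPerPoly_eq_self A fun a ha b => by
        rw [hA, Matrix.transpose_apply, hVinv a ha b]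
        by_cases hab : a = b
        · subst hab; simp
        · rw [if_neg hab, if_neg (Ne.symm hab)]
    -- translate, then take the torus limit
    obtain ⟨hP₁, hJ₁, hJ₁pp⟩ := bfba_translate P hP J hJ hJpp A hAunit 1 one_ne_zero hApp
    obtain ⟨P₂, J₂, hP₂, hJ₂, hJ₂pp, hJ₂in⟩ :=
      bfba_torusLimit _ hP₁ _ hJ₁ hJ₁pp μ ν₀ hμpp
    have hgr₂ : ∀ k ≤ m, ∀ D ∈ J₂ k, ∀ ν : ℤ, weightedHomogeneousComponent μ ν D ∈ J₂ k :=
      fun k _ D hD ν => (hJ₂in k _).2 (bfba_initSpan_graded_set μ _ D ((hJ₂in k D).1 hD) ν)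
    refine ⟨P₂, J₂, hP₂, hJ₂, hJ₂pp, hgr₂, ?_⟩
    -- the subspaces
    obtain hL := bfba_exists_submodule P hP J hJ
    -- rank comparison, degree by degree
    have hcmp : ∀ k ≤ m, ∀ ν : ℤ,
        Module.finrank ℂ ↥(Submodule.span ℂ (J₂ k) ⊓
            restrictSupport ℂ {e : Fin m × Fin m →₀ ℕ | ν ≤ Finsupp.weight μ e}) ≤
          Module.finrank ℂ ↥(Submodule.span ℂ (J k) ⊓
            restrictSupport ℂ {e : Fin m × Fin m →₀ ℕ | ν ≤ Finsupp.weight μ e}) ∧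
        (Module.finrank ℂ ↥(Submodule.span ℂ (J₂ k) ⊓
            restrictSupport ℂ {e : Fin m × Fin m →₀ ℕ | ν ≤ Finsupp.weight μ e}) =
          Module.finrank ℂ ↥(Submodule.span ℂ (J k) ⊓
            restrictSupport ℂ {e : Fin m × Fin m →₀ ℕ | ν ≤ Finsupp.weight μ e}) →
          Module.finrank ℂ ↥((Submodule.span ℂ (J k)).map Φ ⊓
            restrictSupport ℂ {e : Fin m × Fin m →₀ ℕ | ν ≤ Finsupp.weight μ e}) =
          Module.finrank ℂ ↥(Submodule.span ℂ (J k) ⊓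
            restrictSupport ℂ {e : Fin m × Fin m →₀ ℕ | ν ≤ Finsupp.weight μ e})) := by
      intro k hk ν
      obtain ⟨Lk, hLk, hLkle, -⟩ := hL k hk
      have hspan : Submodule.span ℂ (J k) = Lk := by rw [← hLk]; exact Submodule.span_eq Lk
      have hmemLk : ∀ E, E ∈ Lk ↔ E ∈ J k := fun E => by rw [← SetLike.mem_coe, hLk]
      haveI : FiniteDimensional ℂ Lk := Submodule.finiteDimensional_of_le hLkle
      have hgrLk : ∀ D ∈ Lk, ∀ ν : ℤ, weightedHomogeneousComponent μ ν D ∈ Lk :=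
        fun D hD ν => (hmemLk _).2 (hgr k hk D ((hmemLk D).1 hD) ν)
      -- `J₂ k` is the initial span of `V · Lk`
      set L₁ : Submodule ℂ (MvPolynomial (Fin m × Fin m) ℂ) := Lk.map Φ with hL₁
      have hL₁le : L₁ ≤ homogeneousSubmodule (Fin m × Fin m) ℂ k := by
        rintro _ ⟨E, hE, rfl⟩
        rw [hΦapp]
        exact linSubst_mem_homogeneousSubmodule V (hLkle hE)
      have hmemL₁ : ∀ E, E ∈ L₁ ↔ linSubst (Fin m × Fin m) ℂ Aᵀ E ∈ J k := by
        intro E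
        rw [hAT]
        constructor
        · rintro ⟨F, hF, rfl⟩
          rw [hΦapp, bfba_linSubst_inv_linSubst V hVu]
          exact (hmemLk F).1 hF
        · intro h
          refine ⟨linSubst (Fin m × Fin m) ℂ V⁻¹ E, (hmemLk _).2 h, ?_⟩
          rw [hΦapp, bfba_linSubst_linSubst_inv V hVu]
      have hset : {D' : MvPolynomial (Fin m × Fin m) ℂ |
            ∃ E ∈ {D : MvPolynomial (Fin m × Fin m) ℂ | linSubst (Fin m × Fin m) ℂ Aᵀ D ∈ J k}, ∃ ν : ℤ,
              D' = weightedHomogeneousComponent μ ν E ∧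
                ∀ ν' : ℤ, ν' < ν → weightedHomogeneousComponent μ ν' E = 0} =
          {D' : MvPolynomial (Fin m × Fin m) ℂ | ∃ E ∈ L₁, ∃ ν : ℤ,
              D' = weightedHomogeneousComponent μ ν E ∧
                ∀ ν' : ℤ, ν' < ν → weightedHomogeneousComponent μ ν' E = 0} := by
        ext D'
        simp only [Set.mem_setOf_eq, hmemL₁]
      have hspan₂ : Submodule.span ℂ (J₂ k) = Submodule.span ℂ {D' : MvPolynomial (Fin m × Fin m) ℂ |
          ∃ E ∈ L₁, ∃ ν : ℤ, D' = weightedHomogeneousComponent μ ν E ∧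
            ∀ ν' : ℤ, ν' < ν → weightedHomogeneousComponent μ ν' E = 0} := by
        have hcoe : J₂ k = (Submodule.span ℂ {D' : MvPolynomial (Fin m × Fin m) ℂ |
            ∃ E ∈ L₁, ∃ ν : ℤ, D' = weightedHomogeneousComponent μ ν E ∧
              ∀ ν' : ℤ, ν' < ν → weightedHomogeneousComponent μ ν' E = 0} :
                Set (MvPolynomial (Fin m × Fin m) ℂ)) := by
          ext D
          rw [hJ₂in k D, hset, SetLike.mem_coe]
        rw [hcoe, Submodule.span_eq]
      rw [hspan₂, bfba_rank_initSpan μ k L₁ hL₁le ν, hspan]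
      exact ⟨bfba_rank_le μ Lk hgrLk Φ hΦinj hlowΦ ν, fun h => h⟩
    -- strictness in degree `k₀`
    obtain ⟨Lk₀, hLk₀, hLk₀le, -⟩ := hL k₀ hk₀
    have hspan₀ : Submodule.span ℂ (J k₀) = Lk₀ := by rw [← hLk₀]; exact Submodule.span_eq Lk₀
    have hmemLk₀ : ∀ E, E ∈ Lk₀ ↔ E ∈ J k₀ := fun E => by rw [← SetLike.mem_coe, hLk₀]
    haveI : FiniteDimensional ℂ Lk₀ := Submodule.finiteDimensional_of_le hLk₀le
    have hgrLk₀ : ∀ D ∈ Lk₀, ∀ ν : ℤ, weightedHomogeneousComponent μ ν D ∈ Lk₀ :=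
      fun D hD ν => (hmemLk₀ _).2 (hgr k₀ hk₀ D ((hmemLk₀ D).1 hD) ν)
    have hne : Lk₀.map Φ ≠ Lk₀ := by
      intro heq
      apply hnot
      rw [← hmemLk₀, ← heq]
      exact ⟨D₀, (hmemLk₀ _).2 hD₀, rfl⟩
    have hex : ∃ ν₁ : ℤ, ν₁ ∈ Finset.Icc (0 : ℤ) hi ∧
        Module.finrank ℂ ↥(Lk₀.map Φ ⊓ restrictSupport ℂ {e : Fin m × Fin m →₀ ℕ | ν₁ ≤ Finsupp.weight μ e}) ≠
          Module.finrank ℂ ↥(Lk₀ ⊓ restrictSupport ℂ {e : Fin m × Fin m →₀ ℕ | ν₁ ≤ Finsupp.weight μ e}) := by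
      by_contra hall
      push Not at hall
      apply hne
      refine bfba_map_eq_of_rank_eq μ Lk₀ hgrLk₀ Φ hΦinj hlowΦ fun ν => ?_
      by_cases hν : ν ∈ Finset.Icc (0 : ℤ) hi
      · exact hall ν hν
      rw [Finset.mem_Icc, not_and_or, not_le, not_le] at hν
      rcases hν with hν | hν
      · -- `ν < 0`: `F_{≥ν}` is everything
        have htop : ∀ W : Submodule ℂ (MvPolynomial (Fin m × Fin m) ℂ),
            W ⊓ restrictSupport ℂ {e : Fin m × Fin m →₀ ℕ | ν ≤ Finsupp.weight μ e} = W := by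
          intro W
          refine le_antisymm inf_le_left fun D hD => Submodule.mem_inf.2 ⟨hD, ?_⟩
          rw [bfba_mem_Fge]
          intro e _
          exact (hν.le.trans (hw0 e))
        rw [htop, htop]
        exact LinearEquiv.finrank_eq (Submodule.equivMapOfInjective Φ hΦinj Lk₀).symm
      · -- `hi < ν`: `F_{≥ν}` meets degree-`k₀` forms trivially
        have hbot : ∀ W : Submodule ℂ (MvPolynomial (Fin m × Fin m) ℂ),
            W ≤ homogeneousSubmodule (Fin m × Fin m) ℂ k₀ →
            W ⊓ restrictSupport ℂ {e : Fin m × Fin m →₀ ℕ | ν ≤ Finsupp.weight μ e} = ⊥ := by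
          intro W hW
          rw [eq_bot_iff]
          rintro D ⟨hDW, hDF⟩
          rw [Submodule.mem_bot]
          by_contra hD0
          obtain ⟨e, he⟩ := Finset.nonempty_of_ne_empty (mt support_eq_empty.1 hD0)
          have hdeg : e.degree = k₀ := by
            rw [Finsupp.degree_eq_weight_one]
            exact (mem_homogeneousSubmodule k₀ D).1 (hW hDW) (mem_support_iff.1 he)
          have h1 := hμhi e (hdeg.le.trans hk₀)
          have h2 := (bfba_mem_Fge μ).1 hDF e he
          omega
        have hmaple : Lk₀.map Φ ≤ homogeneousSubmodule (Fin m × Fin m) ℂ k₀ := by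
          rintro _ ⟨E, hE, rfl⟩
          rw [hΦapp]
          exact linSubst_mem_homogeneousSubmodule V (hLk₀le hE)
        rw [hbot _ hmaple, hbot _ hLk₀le]
    obtain ⟨ν₁, hν₁, hν₁ne⟩ := hex
    -- sum up
    refine Finset.sum_lt_sum (fun k hk => Finset.sum_le_sum fun ν _ =>
      (hcmp k (Nat.lt_succ_iff.1 (Finset.mem_range.1 hk)) ν).1) ⟨k₀, Finset.mem_range.2 (Nat.lt_succ_of_le hk₀), ?_⟩
    refine Finset.sum_lt_sum (fun ν _ => (hcmp k₀ hk₀ ν).1) ⟨ν₁, hν₁, ?_⟩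
    refine lt_of_le_of_ne (hcmp k₀ hk₀ ν₁).1 fun heq => hν₁ne ?_
    have h := (hcmp k₀ hk₀ ν₁).2 heq
    rwa [hspan₀] at h
  -- induction on the potential
  intro p
  induction p with
  | zero =>
    intro P J hP hJ hJpp hgr hpot
    by_cases hstab : ∀ V : Matrix (Fin m × Fin m) (Fin m × Fin m) ℂ, (∀ a, V a a = 1) →
        (∀ a b : Fin m × Fin m, a ≠ b → V a b ≠ 0 →
          ¬ ((m - n ≤ (a.1 : ℕ) ∧ m - n ≤ (a.2 : ℕ)) ∨ a = (0, 0)) ∧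
            (if (m - n ≤ (b.1 : ℕ) ∧ m - n ≤ (b.2 : ℕ)) ∨ b = (0, 0) then 0 else m * m) +
                ((b.1 : ℕ) * m + (b.2 : ℕ)) <
              (if (m - n ≤ (a.1 : ℕ) ∧ m - n ≤ (a.2 : ℕ)) ∨ a = (0, 0) then 0 else m * m) +
                ((a.1 : ℕ) * m + (a.2 : ℕ))) →
        ∀ k ≤ m, ∀ D ∈ J k, linSubst (Fin m × Fin m) ℂ V D ∈ J k
    · exact ⟨P, J, hP, hJ, hJpp, hgr, hstab⟩
    · simp only [not_forall, exists_prop] at hstab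
      obtain ⟨V, hV1, hUS, k₀, hk₀, D₀, hD₀, hnot⟩ := hstab
      obtain ⟨P', J', -, -, -, -, hlt⟩ := hstep P J hP hJ hJpp hgr V hV1 hUS k₀ hk₀ D₀ hD₀ hnot
      omega
  | succ p ih =>
    intro P J hP hJ hJpp hgr hpot
    by_cases hstab : ∀ V : Matrix (Fin m × Fin m) (Fin m × Fin m) ℂ, (∀ a, V a a = 1) →
        (∀ a b : Fin m × Fin m, a ≠ b → V a b ≠ 0 →
          ¬ ((m - n ≤ (a.1 : ℕ) ∧ m - n ≤ (a.2 : ℕ)) ∨ a = (0, 0)) ∧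
            (if (m - n ≤ (b.1 : ℕ) ∧ m - n ≤ (b.2 : ℕ)) ∨ b = (0, 0) then 0 else m * m) +
                ((b.1 : ℕ) * m + (b.2 : ℕ)) <
              (if (m - n ≤ (a.1 : ℕ) ∧ m - n ≤ (a.2 : ℕ)) ∨ a = (0, 0) then 0 else m * m) +
                ((a.1 : ℕ) * m + (a.2 : ℕ))) →
        ∀ k ≤ m, ∀ D ∈ J k, linSubst (Fin m × Fin m) ℂ V D ∈ J k
    · exact ⟨P, J, hP, hJ, hJpp, hgr, hstab⟩
    · simp only [not_forall, exists_prop] at hstab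
      obtain ⟨V, hV1, hUS, k₀, hk₀, D₀, hD₀, hnot⟩ := hstab
      obtain ⟨P', J', hP', hJ', hJ'pp, hgr', hlt⟩ := hstep P J hP hJ hJpp hgr V hV1 hUS k₀ hk₀ D₀ hD₀ hnot
      exact ih P' J' hP' hJ' hJ'pp hgr' (by omega)

/-- **Borel-fixed border apolarity for the orbit closure of `det_m`** (route `BorderApolarity`,
support item `BorelFixedBorderApolarity`, stmt-ValiantsHypothesis-5781): for `3 ≤ n ≤ m`, if the
padded permanent `X₀₀^{m-n} per_n` lies in `Δ(det_m)` then there are `P_t ∈ GL_{m²} · det_m` and a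
degree-wise (`k ≤ m`) Kuratowski limit `J` of the annihilators `Ann_k(P_t)` which is stable under
the group `H₀(n,m)` (clause W4) and lies in `Ann(pp)` (W5).  Proof: `Y ≠ ∅` (`bfba_nonempty`), the
torus limit of a point of `Y` for the generic anti-dominant cocharacter `μ` is a graded point of `Y`
(`bfba_torusLimit`), the descent `bfba_descent` produces a graded point of `Y` stable under the
unipotent part of `H₀ᵀ`, and W4 follows (`bfba_W4_of_graded_of_unipotent`).  Buczyńska–Buczyński
2021 (Thm 1, Thm 31) transplanted to orbit closures, with Borel's fixed point theorem replaced by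
an explicit descent. -/
theorem BorelFixedBorderApolarity_proof :
    Summit.ValiantsHypothesis.ValiantsHypothesis.Theses.BorderApolarity.BorelFixedBorderApolarity := by
  classical
  intro n m _ h3 hnm
  dsimp only
  intro hmem
  obtain ⟨μ, hμ0, hAD, ⟨ν₀, hμpp⟩, hμ4, hi, hμhi⟩ := bfba_exists_weight n m (by omega) hnm
  obtain ⟨P₀, J₀, hP₀, hJ₀, hJ₀pp⟩ := bfba_nonempty hnm hmem
  obtain ⟨P₁, J₁, hP₁, hJ₁, hJ₁pp, hJ₁in⟩ := bfba_torusLimit P₀ hP₀ J₀ hJ₀ hJ₀pp μ ν₀ hμpp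
  have hgr₁ : ∀ k ≤ m, ∀ D ∈ J₁ k, ∀ ν : ℤ, weightedHomogeneousComponent μ ν D ∈ J₁ k :=
    fun k _ D hD ν => (hJ₁in k _).2
      (bfba_initSpan_graded_set μ _ D ((hJ₁in k D).1 hD) ν)
  obtain ⟨P, J, hP, hJ, hJpp, hgr, hU⟩ :=
    bfba_descent μ ν₀ hμpp hμ0 hi hμhi hAD _ P₁ J₁ hP₁ hJ₁
      hJ₁pp hgr₁ le_rfl
  have hJsub : ∀ k ≤ m, ∃ Lk : Submodule ℂ (MvPolynomial (Fin m × Fin m) ℂ),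
      (Lk : Set (MvPolynomial (Fin m × Fin m) ℂ)) = J k ∧ Lk ≤ homogeneousSubmodule (Fin m × Fin m) ℂ k :=
    fun k hk => by
      obtain ⟨Lk, h1, h2, -⟩ := bfba_exists_submodule P hP J hJ k hk
      exact ⟨Lk, h1, h2⟩
  refine ⟨P, J, hP, hJ.1, hJ.2, ?_, hJpp⟩
  intro A ha hb hc hd k hk D hD
  exact bfba_W4_of_graded_of_unipotent n m μ hμ4 J hJsub hgr hU (A : Matrix (Fin m × Fin m) (Fin m × Fin m) ℂ)
    ((Matrix.isUnit_iff_isUnit_det _).1 (Units.isUnit A)) ha hb hc k hk D hD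

end Summit.ValiantsHypothesis.ValiantsHypothesis.Theorems.BorderApolarityBorelFixedBorderApolarity
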